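import Mathlib
import Summits.NavierStokesRegularity.NavierStokesRegularity.Theses.ThreadingFlux
import HarnessLib

/-!
# `ThreadingFlux.Assembly` — the route's assembly (item stmt-NavierStokesRegularity-1223; pure logic)

**Statement.** `UnthreadedNoBlowup → ThreadedNoBlowup → NoTypeII → NoBlowupToClay →
NavierStokesRegularity` (signatures expanded in the route file).

PROOF (the planner's `assembly_holds`, ~10 lines). Fix `ν, T, u, p` classical on `[0,T)`, Leray–Hopf
from a rapidly decaying datum; if `u` had no smooth extension past `T` it would be a maximal smooth
solution (`IsMaximalSmoothSolution` := classical ∧ ¬`HasSmoothExtensionPast`), hence Type I by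
`NoTypeII`, hence — by cases on «every `x₀` is unthreaded» — extendable by `UnthreadedNoBlowup` or by
`ThreadedNoBlowup`, contradiction; so no blow-up, and `NoBlowupToClay`
(item stmt-NavierStokesRegularity-0055) yields Clay (A).  (The route file's own `closes` takes
`Assembly` itself as a hypothesis, so it cannot be used here.)

HONEST FRAMING: glue between the route's own statements (about HYPOTHETICAL objects); nothing
here bears on the regularity problem itself.
-/

noncomputable section

set_option linter.dupNamespace false

namespace Summit.NavierStokesRegularity.NavierStokesRegularity.Theorems

/-- **Item stmt-NavierStokesRegularity-1223** (`ThreadingFlux.Assembly`): the unthreaded and the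
threaded continuation statements, no Type II and `NoBlowupToClay` give Clay (A), by excluded middle
on the threading condition at a putative first singular time. [this file] -/
theorem threadingFlux_assembly_proof :
    Summit.NavierStokesRegularity.NavierStokesRegularity.Theses.ThreadingFlux.Assembly := by
  unfold Summit.NavierStokesRegularity.NavierStokesRegularity.Theses.ThreadingFlux.Assembly
  intro hUn hTh hII hClay
  refine hClay fun ν T hν hT u p hcl hLH hdec => ?_
  by_contra hext
  have hmax : Literature.Analysis.FluidPDE.IsMaximalSmoothSolution ν 0 u p T := ⟨hcl, hext⟩
  have hTI := hII ν T hν hT u p hmax hLH hdec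
  exact hext ((Classical.em _).elim (hUn ν T hν hT u p hcl hLH hdec hTI)
    (hTh ν T hν hT u p hcl hLH hdec hTI))

end Summit.NavierStokesRegularity.NavierStokesRegularity.Theorems

end
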